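import Literature.Combinatorics.Optimization.BlockPsdLiftFactorization
import Literature.Barriers.PneNP.TSPExtensionComplexityFactorization
import Literature.Combinatorics.Optimization.ZeroOnePolytopesHighPsdRank
import HarnessLib

/-!
# LP lifts: extended formulations (`HasEFOfSize`) versus `(S^1_+)^r`-lifts (`HasBlockPsdLift · 1 r`)

Two vocabularies for linear extended formulations live in the tree: the Barriers files' slack-form
`Literature.Barriers.PneNP.HasEFOfSize P r` (`P = {x : ∃ y ≥ 0, Ex + Fy = g}` with `r` sign constraints;
Fiorini et al. / Rothvoß) and the cone-lift form `HasBlockPsdLift P 1 r` (`P = π(ℝ^r_+ ∩ L)`, `π` linear,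
`L` affine; Gouveia–Parrilo–Thomas [cite: GouveiaParriloThomas2013, Def. 2.2 (§2)], Fawzi–Parrilo's case
`d = 1` [cite: FawziParrilo2013, §1.2 (p. 4)]).  This file PROVES the dictionary (no facts asserted):

* `HasEFOfSize.hasPsdPowerFactorization_slack` — Yannakakis "EF ⇒ nonnegative factorization"
  [cite: Rothvoss2017, Thm. 4 (PDF p. 5)] (the tree's `HasEFOfSize.exists_nonneg_factorisation`, `r + 1` terms)
  in the currency `FixedSizePsdRank.HasPsdPowerFactorization · 1 (r+1)`;
* `HasEFOfSize.hasBlockPsdLift_one` — an EF of size `r` of a polytope with both descriptions is an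
  `(S^1_+)^{r+1}`-lift (via GPT "factorization ⇒ lift", `hasPsdPowerFactorization_slack_iff_hasBlockPsdLift`), and
  `HasEFOfSize.hasPsdLift` — hence a psd lift of size `r + 1` ("LP ⊆ SDP");
* `HasBlockPsdLift.hasEFOfSize` — conversely an `(S^1_+)^r`-lift of ANY set `P ⊆ ℝ^ι` is an EF of size `r`
  (equations: the coordinates of `y` modulo `L.direction` in a basis of the quotient, and `x = π(y)`).
* `Rothvoss2013_thm4_blocks_one`, `ZeroOneLpEF.exists_zeroOne_two_pow_le_blocks_one` — Rothvoß's counting bound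
  [cite: Rothvoss2013, Thm. 4] transported to `(S^1_+)^r`-lifts.
So the tree's extension complexity and the least number of `S^1_+` blocks in a lift differ by at most `1`
(the `+1` is the constant column of the slack-form factorization; it disappears for `dim P ≥ 1` in the printed
treatments, which is not needed for lower bounds).
-/

noncomputable section

open Finset Matrix
open scoped MatrixOrder

namespace Literature.Combinatorics.Optimization

open Literature.Barriers.PneNP FixedSizePsdRank

/-! ### EF ⇒ `(S^1_+)^{r+1}`-factorization ⇒ `(S^1_+)^{r+1}`-lift -/

/-- **Yannakakis, direction "EF ⇒ factorization", in the `(S^1_+)^r` currency**: an extended formulation of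
size `r` of `P` gives an `(S^1_+)^{r+1}`-factorization (= nonnegative factorization of size `r + 1`, the `+1`
being the constant column of the tree's `HasEFOfSize.exists_nonneg_factorisation`) of the slack matrix of ANY
family of points of `P` against ANY family of valid inequalities.
[cite: Rothvoss2017, Thm. 4 (PDF p. 5)] [cite: FawziParrilo2013, §1.2 (p. 4, "LP … captured by the case d = 1")] -/
theorem _root_.Literature.Barriers.PneNP.HasEFOfSize.hasPsdPowerFactorization_slack {ι : Type} [Fintype ι]
    {r : ℕ} {P : Set (ι → ℝ)} (h : HasEFOfSize P r) {A B : Type*} (v : B → ι → ℝ) (hv : ∀ b, v b ∈ P)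
    (c : A → ι → ℝ) (d : A → ℝ) (hvalid : ∀ a, ∀ x ∈ P, c a ⬝ᵥ x ≤ d a) :
    HasPsdPowerFactorization (fun b a => d a - c a ⬝ᵥ v b) 1 (r + 1) := by
  obtain ⟨U, V, hU, hV, hS⟩ := h.exists_nonneg_factorisation v hv c d hvalid
  let e : Fin (r + 1) ≃ Option (Fin r) := finSuccEquiv r
  refine hasPsdPowerFactorization_one_iff_nonneg.2
    ⟨fun b t => V (e t) b, fun a t => U a (e t), fun b t => hV _ _, fun a t => hU _ _, fun b a => ?_⟩
  rw [hS a b, ← Equiv.sum_comp e]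
  exact Finset.sum_congr rfl fun t _ => mul_comm _ _

/-- **An extended formulation of size `r` of a polytope is an `(S^1_+)^{r+1}`-lift** (for a polytope given by
both descriptions `conv{x_i} = {y : a_jᵀy ≤ b_j}`): Yannakakis' factorization followed by Gouveia–Parrilo–Thomas
("factorization ⇒ lift", `hasPsdPowerFactorization_slack_iff_hasBlockPsdLift`).
[cite: Rothvoss2017, Thm. 4 (PDF p. 5)] [cite: GouveiaParriloThomas2013, Thm. 2.4 (§2)] -/
theorem _root_.Literature.Barriers.PneNP.HasEFOfSize.hasBlockPsdLift_one {ι : Type} [Fintype ι]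
    {κ J : Type*} [Finite κ] {r : ℕ} {x : κ → ι → ℝ} {a : J → ι → ℝ} {b : J → ℝ}
    (hPQ : convexHull ℝ (Set.range x) = {y | ∀ j, a j ⬝ᵥ y ≤ b j})
    (h : HasEFOfSize (convexHull ℝ (Set.range x)) r) :
    HasBlockPsdLift (convexHull ℝ (Set.range x)) 1 (r + 1) :=
  (hasPsdPowerFactorization_slack_iff_hasBlockPsdLift le_rfl (by omega) hPQ).1
    (h.hasPsdPowerFactorization_slack x (fun i => subset_convexHull ℝ _ ⟨i, rfl⟩) a b
      (fun j y hy => by rw [hPQ] at hy; exact hy j))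

/-- Hence an extended formulation of size `r` of such a polytope is also a psd lift of size `r + 1`
("LP ⊆ SDP": `(S^1_+)^{r+1} ⊆ S^{r+1}_+`). [cite: FawziParrilo2013, §1.1 (p. 3)] -/
theorem _root_.Literature.Barriers.PneNP.HasEFOfSize.hasPsdLift {ι : Type} [Fintype ι]
    {κ J : Type*} [Finite κ] {r : ℕ} {x : κ → ι → ℝ} {a : J → ι → ℝ} {b : J → ℝ}
    (hPQ : convexHull ℝ (Set.range x) = {y | ∀ j, a j ⬝ᵥ y ≤ b j})
    (h : HasEFOfSize (convexHull ℝ (Set.range x)) r) :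
    HasPsdLift (convexHull ℝ (Set.range x)) (r + 1) := by
  simpa using HasBlockPsdLift.hasPsdLift (h.hasBlockPsdLift_one hPQ)

/-! ### `(S^1_+)^r`-lift ⇒ EF of size `r` -/

/-- A linear functional on `ℝ^r` is the dot product with its values on the coordinate vectors. [folklore] -/
private theorem dotProduct_single_eq_apply {r : ℕ} (f : (Fin r → ℝ) →ₗ[ℝ] ℝ) (y : Fin r → ℝ) :
    (fun t => f (Pi.single t 1)) ⬝ᵥ y = f y := by
  have hy : y = ∑ t, y t • (Pi.single t (1 : ℝ) : Fin r → ℝ) := by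
    funext s
    simp [Finset.sum_apply, Pi.single_apply]
  conv_rhs => rw [hy]
  rw [map_sum, dotProduct]
  exact Finset.sum_congr rfl fun t _ => by rw [map_smul, smul_eq_mul, mul_comm]

/-- **A `(S^1_+)^r`-lift (`= (ℝ^r_+)`-lift, `π` linear, `L` affine) of `P ⊆ ℝ^ι` is an extended formulation
of size `r`** in the tree's slack form `{x : ∃ y ≥ 0, Ex + Fy = g}`: the equations are those cutting out `L`
(coordinates modulo `L.direction`) and `x = π(y)`. With `HasEFOfSize.hasBlockPsdLift_one`: for polytopes the
tree's extension complexity `xc` and the least `r` with an `(S^1_+)^r`-lift differ by at most `1`.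
[cite: GouveiaParriloThomas2013, Def. 2.2 (§2, "ℝ^m_+-lifts … linear programming")] [cite: FawziParrilo2013, §1.2 (p. 4)] -/
theorem HasBlockPsdLift.hasEFOfSize {ι : Type} [Fintype ι] {P : Set (ι → ℝ)} {r : ℕ}
    (h : HasBlockPsdLift P 1 r) : HasEFOfSize P r := by
  classical
  obtain ⟨L, π, rfl⟩ := h
  -- coordinates `ℝ^r ≅ (S^1)^r`
  let φ : (Fin r → ℝ) →ₗ[ℝ] (Fin r → Matrix (Fin 1) (Fin 1) ℝ) :=
    { toFun := fun y t => y t • (1 : Matrix (Fin 1) (Fin 1) ℝ)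
      map_add' := fun y z => funext fun t => by simp [add_smul]
      map_smul' := fun c y => funext fun t => by simp [mul_smul] }
  let ψ : (Fin r → Matrix (Fin 1) (Fin 1) ℝ) →ₗ[ℝ] (Fin r → ℝ) :=
    { toFun := fun M t => M t 0 0
      map_add' := fun M N => rfl
      map_smul' := fun c M => rfl }
  have hφ : ∀ y t, φ y t = y t • (1 : Matrix (Fin 1) (Fin 1) ℝ) := fun y t => rfl
  have hψ : ∀ M t, ψ M t = M t 0 0 := fun M t => rfl
  have hφψ : ∀ M : Fin r → Matrix (Fin 1) (Fin 1) ℝ, φ (ψ M) = M := fun M => by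
    funext t
    ext i j
    fin_cases i; fin_cases j
    simp [hφ, hψ]
  have hψφ : ∀ y, ψ (φ y) = y := fun y => funext fun t => by simp [hφ, hψ]
  -- empty `L`: `P = ∅`
  by_cases hL : ∃ M₁, M₁ ∈ L
  swap
  · push Not at hL
    have hP : π '' {M : Fin r → Matrix (Fin 1) (Fin 1) ℝ | (∀ t, (M t).PosSemidef) ∧ M ∈ L} = ∅ :=
      Set.eq_empty_of_forall_notMem (by rintro _ ⟨M, ⟨-, hM⟩, rfl⟩; exact hL M hM)
    rw [hP]
    refine ⟨⟨1, 0, 0, fun _ => 1⟩, Set.eq_empty_of_forall_notMem ?_⟩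
    rintro x ⟨y, -, hy⟩
    have := congrFun hy 0
    simp at this
  obtain ⟨M₁, hM₁⟩ := hL
  -- `L` in coordinates and its equations
  let L' : AffineSubspace ℝ (Fin r → ℝ) := L.comap φ.toAffineMap
  have hL' : ∀ y, y ∈ L' ↔ φ y ∈ L := fun y => AffineSubspace.mem_comap
  have hy₁ : ψ M₁ ∈ L' := by rw [hL', hφψ]; exact hM₁
  set W : Submodule ℝ (Fin r → ℝ) := L'.direction with hW
  let bQ := Module.finBasis ℝ ((Fin r → ℝ) ⧸ W)
  let ℓ : Fin (Module.finrank ℝ ((Fin r → ℝ) ⧸ W)) → ((Fin r → ℝ) →ₗ[ℝ] ℝ) :=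
    fun i => (bQ.coord i).comp W.mkQ
  have hℓ : ∀ y : Fin r → ℝ, y ∈ L' ↔ ∀ i, ℓ i y = ℓ i (ψ M₁) := by
    intro y
    have hquot : W.mkQ y = W.mkQ (ψ M₁) ↔ y ∈ L' := by
      rw [Submodule.mkQ_apply, Submodule.mkQ_apply, Submodule.Quotient.eq, ← vsub_eq_sub]
      exact AffineSubspace.vsub_right_mem_direction_iff_mem hy₁ y
    rw [← hquot, bQ.ext_elem_iff]
    rfl
  -- the extended formulation: rows `Fin k₀ ⊕ ι`, `k₀ = dim (ℝ^r / L.direction)`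
  let ρ : Fin (Module.finrank ℝ ((Fin r → ℝ) ⧸ W)) ⊕ ι ≃
      Fin (Module.finrank ℝ ((Fin r → ℝ) ⧸ W) + Fintype.card ι) :=
    (Equiv.sumCongr (Equiv.refl _) (Fintype.equivFin ι)).trans finSumFinEquiv
  let Erow : Fin (Module.finrank ℝ ((Fin r → ℝ) ⧸ W)) ⊕ ι → ι → ℝ := fun s =>
    match s with
    | Sum.inl _ => 0
    | Sum.inr i => Pi.single i 1
  let Frow : Fin (Module.finrank ℝ ((Fin r → ℝ) ⧸ W)) ⊕ ι → Fin r → ℝ := fun s =>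
    match s with
    | Sum.inl i => fun t => ℓ i (Pi.single t 1)
    | Sum.inr i => fun t => -((π (φ (Pi.single t 1))) i)
  let grow : Fin (Module.finrank ℝ ((Fin r → ℝ) ⧸ W)) ⊕ ι → ℝ := fun s =>
    match s with
    | Sum.inl i => ℓ i (ψ M₁)
    | Sum.inr _ => 0
  -- the row equations, decoded
  have hFinl : ∀ i y, Frow (Sum.inl i) ⬝ᵥ y = ℓ i y := fun i y => dotProduct_single_eq_apply (ℓ i) y
  have hFinr : ∀ (i : ι) y, Frow (Sum.inr i) ⬝ᵥ y = -((π (φ y)) i) := by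
    intro i y
    have := dotProduct_single_eq_apply ((LinearMap.proj i).comp (π ∘ₗ φ)) y
    simp only [LinearMap.comp_apply, LinearMap.proj_apply] at this
    rw [← this, ← neg_dotProduct]
    rfl
  refine ⟨⟨Module.finrank ℝ ((Fin r → ℝ) ⧸ W) + Fintype.card ι, Matrix.of fun q => Erow (ρ.symm q),
    Matrix.of fun q => Frow (ρ.symm q), fun q => grow (ρ.symm q)⟩, ?_⟩
  have hsys : ∀ (x : ι → ℝ) (y : Fin r → ℝ),
      (Matrix.of fun q => Erow (ρ.symm q)) *ᵥ x + (Matrix.of fun q => Frow (ρ.symm q)) *ᵥ y =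
          (fun q => grow (ρ.symm q)) ↔
        (∀ i, ℓ i y = ℓ i (ψ M₁)) ∧ ∀ i : ι, x i = (π (φ y)) i := by
    intro x y
    constructor
    · intro hEq
      have hrow : ∀ s, Erow s ⬝ᵥ x + Frow s ⬝ᵥ y = grow s := fun s => by
        have := congrFun hEq (ρ s)
        simpa [Matrix.mulVec, Matrix.of_apply] using this
      refine ⟨fun i => ?_, fun i => ?_⟩
      · have := hrow (Sum.inl i)
        rw [hFinl] at this
        simpa [Erow, grow] using this
      · have := hrow (Sum.inr i)
        rw [hFinr] at this
        simp only [Erow, grow, single_dotProduct, one_mul] at this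
        linarith
    · rintro ⟨h1, h2⟩
      funext q
      obtain ⟨s, rfl⟩ := ρ.surjective q
      change (fun q' => Erow (ρ.symm (ρ s)) q') ⬝ᵥ x + (fun q' => Frow (ρ.symm (ρ s)) q') ⬝ᵥ y = grow (ρ.symm (ρ s))
      rw [Equiv.symm_apply_apply]
      change Erow s ⬝ᵥ x + Frow s ⬝ᵥ y = grow s
      rcases s with i | i
      · rw [hFinl]; simp [Erow, grow, h1 i]
      · rw [hFinr]; simp [Erow, grow, single_dotProduct, h2 i]
  ext x
  simp only [ExtendedFormulation.projSet, Set.mem_setOf_eq, Set.mem_image]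
  constructor
  · rintro ⟨y, hy0, hEq⟩
    obtain ⟨h1, h2⟩ := (hsys x y).1 hEq
    refine ⟨φ y, ⟨fun t => ?_, (hL' y).1 ((hℓ y).2 h1)⟩, (funext h2).symm⟩
    rw [hφ]
    exact Matrix.PosSemidef.one.smul (hy0 t)
  · rintro ⟨M, ⟨hM, hML⟩, rfl⟩
    refine ⟨ψ M, fun t => ?_, (hsys _ _).2 ⟨(hℓ _).1 ?_, fun i => by rw [hφψ]⟩⟩
    · rw [hψ]; exact (hM t).diag_nonneg
    · rw [hL', hφψ]; exact hML

/-! ### Rothvoß's counting bound for `(S^1_+)^r`-lifts -/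

/-- **Rothvoß 2013 Thm. 4 in the `(S^1_+)^r`-lift currency**: some `0/1` polytopes in `ℝⁿ` need
`r ≥ c·2^{n/2}/√(n log 2n)` for every `(S^1_+)^r`-lift (= LP lift in Gouveia–Parrilo–Thomas form), by
`HasBlockPsdLift.hasEFOfSize` and the tree's `Rothvoss2013_thm4_holds`. [cite: Rothvoss2013, Thm. 4 (§4, p. 7)]
[cite: FawziParrilo2013, §1.2 (p. 4, "LP … captured by the case d = 1")] -/
theorem Rothvoss2013_thm4_blocks_one :
    ∃ c : ℝ, 0 < c ∧ ∃ n₀ : ℕ, ∀ n : ℕ, n₀ ≤ n → ∃ 𝒳 : Set (Fin n → ℝ),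
      𝒳 ⊆ {x | ∀ i, x i = 0 ∨ x i = 1} ∧
      ∀ r : ℕ, HasBlockPsdLift (convexHull ℝ 𝒳) 1 r →
        c * (2 : ℝ) ^ ((n : ℝ) / 2) / Real.sqrt ((n : ℝ) * Real.log (2 * n)) ≤ r := by
  obtain ⟨c, hc, n₀, H⟩ := Rothvoss2013_thm4_holds
  refine ⟨c, hc, n₀, fun n hn => ?_⟩
  obtain ⟨𝒳, h𝒳, hk⟩ := H n hn
  exact ⟨𝒳, h𝒳, fun r h => hk r h.hasEFOfSize⟩

/-- The sharp log-free form: for `n ≥ 20` some nonempty `𝒳 ⊆ {0,1}ⁿ` has `2ⁿ ≤ 96·n·r²` for every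
`(S^1_+)^r`-lift of `conv 𝒳`. [cite: Rothvoss2013, Thm. 4 (§4, p. 7)] [cite: FawziParrilo2013, §1.2 (p. 4)] -/
theorem ZeroOneLpEF.exists_zeroOne_two_pow_le_blocks_one {n : ℕ} (hn : 20 ≤ n) :
    ∃ 𝒳 : Finset (Fin n → Bool), 𝒳.Nonempty ∧
      ∀ r : ℕ, HasBlockPsdLift (convexHull ℝ (cubePoint '' (𝒳 : Set (Fin n → Bool)))) 1 r →
        2 ^ n ≤ 96 * n * r ^ 2 := by
  obtain ⟨𝒳, hne, hk⟩ := ZeroOneLpEF.exists_zeroOne_two_pow_le_mul_sq hn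
  exact ⟨𝒳, hne, fun r h => hk r h.hasEFOfSize⟩

end Literature.Combinatorics.Optimization
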